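import Literature.RepresentationTheory.BorelWallach2000.UpqHarmonicHodgeDecomposition
import Literature.RepresentationTheory.BorelWallach2000.TrivialModuleGKCohomologyUnitary
import Literature.RepresentationTheory.KonnoKonno2007.JunctionLinearRealGroup
import Literature.Algebra.Lie.ChevalleyEilenbergLowDegree
import HarnessLib

/-!
# FLOOR-0 P3b «ENGINE local packets», line `F0_EngineLocalPackets` ed. 2 — STUB T6k CLOSED: the `𝔭`-geometry of
# `U(2,1)` for `(𝔤, K)`-1-cochains of `J`-type `δ = ±1` (kernel `= 𝔨`; Schur: a second cochain with values in
# `span f(𝔤)` is a complex multiple of `f`)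

Cell hodgecm-mathlib (D-0151), FLOOR 0, crux item H413 = stmt-HodgeConjecture-24833; sub-line
`Cruxes/H413/Lines/F0_EngineLocalPackets.lean` edition 2 (F0P3b-plan (g2), tree sha16 843c62f29c241097), registered
stub `stub_T6k_u21PGeometry : StubT6kU21PGeometry` (§2 there, :359–376).  PROOF lane (theorems only); author
F0P3-p04 (g2) (share ruled by F0P3-plan (g0) 23:03:15Z ∕ director s377).  Stub-closer protocol (director s347): the
Lines module is NOT imported; `stubT6k_holds` has the body of `StubT6kU21PGeometry` as its TYPE, binder for binder
(no Lines-local predicate occurs), so `theorem stub_T6k_u21PGeometry : StubT6kU21PGeometry :=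
F0P3bStubT6kU21PGeometry.stubT6k_holds` is the by-name fold.

THE ARGUMENT (two explicit elements of `K = U(2) × U(1)`; no transitivity theorem, no abstract Schur lemma).  For a
`(𝔤, K)`-1-cochain `f` of type `δ = ±1` and the unit directions `u_p = X_{E_p}` of `𝔭 ≅ ℂ²` (★ `upqUnit`):
(a) COORDINATES `f(X) = λ(X₀) f(u₀) + λ(X₁) f(u₁)`, `λ(c) = Re c + δ i Im c` (`λ(c) = 0 ↔ c = 0`), `X_p` the
`𝔭`-block entries (`f` kills `𝔨`; `f(⁅z₀, Y⁆) = δ i f(Y)` by ★ `mem_upqType_iff` + `θ_{z₀} f = 0`; Cartan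
decomposition ★ `upq_sub_offDiag_mem_kInLie`).  (b) PHASE `κ₀ = diag(i, 1; 1)` (★ `phaseDiag`,
★ `upq_kV_mem_maximalCompact`, ★ `upq_Ad_kV_offDiag`): `Ad κ₀ u₀ = ⁅z₀, u₀⁆`, `Ad κ₀ u₁ = u₁`, so `ρK(κ₀)` acts by
`δ i ≠ 1` on `f(u₀)` and by `1` on `f(u₁)` and a relation `a f(u₀) + b f(u₁) = w` splits.  (c) ROTATION
`κ_r = diag(w, 1)`, `w = (1/5)[[3,4],[−4,3]]` (★ `rotW`) mixes `u₀, u₁` with non-zero coefficients: `f ≠ 0` forces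
`f(u₀) ≠ 0 ≠ f(u₁)`.  Then (1): `f(X) = 0 ⇒ λ(X₀) = λ(X₁) = 0 ⇒ X ∈ 𝔨` (★ `upq_mem_kInLie_iff_blocks`); (2):
`g(u₀) = a f(u₀)`, `g(u₁) = b′ f(u₁)` (phase), `b′ = a` (rotation), `g = a • f` (coordinates).
[cite: BorelWallach2000, II §4.1–4.2] [cite: Rogawski1990, §12.3 p. 178]

HONEST LABEL: HC_CM is proved only modulo the printed citations until rung 0 closes; this file discharges none.
-/

-- Mathlib idiom (as in `GKModules`, `GKCohomology`, the `Upq*` files): commutator bracket on `Module.End`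
attribute [local instance 100] LieRing.ofAssociativeRing

set_option autoImplicit false
set_option linter.dupNamespace false

noncomputable section

open scoped Matrix ComplexConjugate

namespace Summit.HodgeConjecture.HodgeConjecture.Cruxes.H413.F0P3bStubT6kU21PGeometry

open Literature.Algebra.Lie Literature.Algebra.Lie.ChevalleyEilenberg
open Literature.NumberTheory.Automorphic
open Literature.RepresentationTheory.BorelWallach2000
open Literature.RepresentationTheory.KonnoKonno2007 Literature.RepresentationTheory.KonnoKonno2007.RealDualPair
open Literature.RepresentationTheory.KonnoKonno2007.RealDualPair.UForm

/-! ## §1 Glue on `(𝔤, K)`-1-cochains of `U(α, β)` (generic) -/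
section Generic

variable {α β : Type} [Fintype α] [DecidableEq α] [Fintype β] [DecidableEq β]
  {V : Type} [AddCommGroup V] [Module ℂ V]
  (ρK : Representation ℂ (uFormGroup α β).maximalCompact V) (ρ𝔤 : (uFormGroup α β).lie →ₗ⁅ℝ⁆ Module.End ℂ V)
  (hV : ∀ (k : (uFormGroup α β).maximalCompact) (X : (uFormGroup α β).lie), ρK k ∘ₗ ρ𝔤 X ∘ₗ ρK k⁻¹ =
    ρ𝔤 ((uFormGroup α β).Ad (Subgroup.inclusion (uFormGroup α β).maximalCompact_le_carrier k) X))

/-- Additivity of a 1-cochain in its (single) argument. [folklore] -/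
theorem cochainOne_apply_add (f : Cochain ℝ (uFormGroup α β).lie (GKCarrier (uFormGroup α β) ρ𝔤) 1)
    (X Y : (uFormGroup α β).lie) : f ![X + Y] = f ![X] + f ![Y] :=
  f.map_vecCons_add ![] X Y

/-- Real homogeneity of a 1-cochain, with the scalar moved to `ℂ` on the value. [folklore] -/
theorem cochainOne_apply_smul (f : Cochain ℝ (uFormGroup α β).lie (GKCarrier (uFormGroup α β) ρ𝔤) 1)
    (r : ℝ) (X : (uFormGroup α β).lie) : f ![r • X] = (r : ℂ) • f ![X] := by
  rw [f.map_vecCons_smul ![] r X]; rfl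

/-- A 1-cochain all of whose values `f(Y)` vanish is zero. [folklore] -/
theorem cochainOne_eq_zero {f : Cochain ℝ (uFormGroup α β).lie (GKCarrier (uFormGroup α β) ρ𝔤) 1}
    (h : ∀ Y : (uFormGroup α β).lie, f ![Y] = 0) : f = 0 := by
  ext v
  have hv : v = ![v 0] := by funext i; fin_cases i; rfl
  rw [hv, AlternatingMap.zero_apply]
  exact h (v 0)

/-- A `(𝔤, K)`-1-cochain vanishes on `𝔨` (horizontality). [cite: BorelWallach2000, I §5.1 (2)] -/
theorem apply_eq_zero_of_mem_kInLie {f : Cochain ℝ (uFormGroup α β).lie (GKCarrier (uFormGroup α β) ρ𝔤) 1}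
    (hf : f ∈ (gkComplex (uFormGroup α β) ρK ρ𝔤 hV).carrier 1) {Z : (uFormGroup α β).lie}
    (hZ : Z ∈ (uFormGroup α β).kInLie) : f ![Z] = 0 := by
  have h := (((mem_gkComplex_succ_iff (uFormGroup α β) ρK ρ𝔤 hV 0 f).1 hf).1 Z hZ).2
  have e := congrArg (fun g : Cochain ℝ (uFormGroup α β).lie (GKCarrier (uFormGroup α β) ρ𝔤) 0 => g ![]) h
  simpa only [ins_apply, AlternatingMap.zero_apply] using e

/-- `𝔨`-equivariance of a `(𝔤, K)`-1-cochain: `ρ𝔤(Z) f(Y) = f(⁅Z, Y⁆)` for `Z ∈ 𝔨` (`θ_Z f = 0`).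
[cite: BorelWallach2000, I §5.1 (2)] -/
theorem lie_apply_of_mem_kInLie {f : Cochain ℝ (uFormGroup α β).lie (GKCarrier (uFormGroup α β) ρ𝔤) 1}
    (hf : f ∈ (gkComplex (uFormGroup α β) ρK ρ𝔤 hV).carrier 1) {Z : (uFormGroup α β).lie}
    (hZ : Z ∈ (uFormGroup α β).kInLie) (Y : (uFormGroup α β).lie) :
    ρ𝔤 Z (f ![Y] : V) = f ![⁅Z, Y⁆] := by
  have h : lieDer ℝ (uFormGroup α β).lie (GKCarrier (uFormGroup α β) ρ𝔤) 1 Z f = 0 :=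
    (((mem_gkComplex_succ_iff (uFormGroup α β) ρK ρ𝔤 hV 0 f).1 hf).1 Z hZ).1
  have e := congrArg (fun g : Cochain ℝ (uFormGroup α β).lie (GKCarrier (uFormGroup α β) ρ𝔤) 1 => g ![Y]) h
  simp only [lieDer_one_apply, AlternatingMap.zero_apply, sub_eq_zero] at e
  exact e

/-- `K`-equivariance of a `(𝔤, K)`-1-cochain: `ρK(κ) f(Y) = f(Ad(κ) Y)` (`κ • f = f`), with `ρK(κ)` in its
`GKCarrier` dress `(gkPairAction …).τ κ`. [cite: BorelWallach2000, I §5.1 (3)] -/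
theorem kAct_apply {f : Cochain ℝ (uFormGroup α β).lie (GKCarrier (uFormGroup α β) ρ𝔤) 1}
    (hf : f ∈ (gkComplex (uFormGroup α β) ρK ρ𝔤 hV).carrier 1) (κ : (uFormGroup α β).maximalCompact)
    (Y : (uFormGroup α β).lie) :
    (gkPairAction (uFormGroup α β) ρK ρ𝔤 hV).τ κ (f ![Y]) =
      f ![(uFormGroup α β).Ad (Subgroup.inclusion (uFormGroup α β).maximalCompact_le_carrier κ) Y] := by
  have h := ((mem_gkComplex_succ_iff (uFormGroup α β) ρK ρ𝔤 hV 0 f).1 hf).2 κ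
  have e := congrArg (fun g : Cochain ℝ (uFormGroup α β).lie (GKCarrier (uFormGroup α β) ρ𝔤) 1 =>
    g ![(uFormGroup α β).Ad (Subgroup.inclusion (uFormGroup α β).maximalCompact_le_carrier κ) Y]) h
  simp only [PairAction.act_apply] at e
  have hv : (fun i => (gkPairAction (uFormGroup α β) ρK ρ𝔤 hV).σ κ⁻¹
      (![(uFormGroup α β).Ad (Subgroup.inclusion (uFormGroup α β).maximalCompact_le_carrier κ) Y] i)) = ![Y] := by
    funext i; fin_cases i; exact PairAction.σ_apply_inv _ κ Y
  rwa [hv] at e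

/-- **The type on the arguments**: a type-`δ` cochain has `f(⁅z₀, Y⁆) = δ i · f(Y)`.
[cite: BorelWallach2000, II §4.2 (3)] -/
theorem apply_lie_upqZ0 {δ : ℤ} {f : Cochain ℝ (uFormGroup α β).lie (GKCarrier (uFormGroup α β) ρ𝔤) 1}
    (hf : f ∈ upqType ρK ρ𝔤 hV 1 δ) (Y : (uFormGroup α β).lie) :
    f ![⁅upqZ0 α β, Y⁆] = ((δ : ℂ) * Complex.I) • f ![Y] := by
  obtain ⟨hfC, hfz⟩ := (mem_upqType_iff ρK ρ𝔤 hV 1 δ f).1 hf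
  rw [← lie_apply_of_mem_kInLie ρK ρ𝔤 hV hfC upqZ0_mem_kInLie Y]
  exact hfz ![Y]

/-- **Values on the unit directions**: `f(X_{cE_q}) = (Re c + δ i Im c) · f(X_{E_q})` for a type-`δ` cochain.
[cite: BorelWallach2000, II §4.2 (3)] -/
theorem apply_upqUnit {δ : ℤ} {f : Cochain ℝ (uFormGroup α β).lie (GKCarrier (uFormGroup α β) ρ𝔤) 1}
    (hf : f ∈ upqType ρK ρ𝔤 hV 1 δ) (q : α × β) (c : ℂ) :
    f ![upqUnit q c] = ((c.re : ℂ) + (c.im : ℂ) * ((δ : ℂ) * Complex.I)) • f ![upqUnit q 1] := by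
  have hc : upqUnit q c = c.re • upqUnit q 1 + c.im • ⁅upqZ0 α β, upqUnit q 1⁆ := by
    rw [lie_upqZ0_upqUnit, upq_real_smul_upqUnit, upq_real_smul_upqUnit, upqUnit_add, mul_one, mul_one,
      Complex.re_add_im]
  rw [hc, cochainOne_apply_add, cochainOne_apply_smul, cochainOne_apply_smul, apply_lie_upqZ0 ρK ρ𝔤 hV hf,
    smul_smul, ← add_smul]

end Generic

/-! ## §2 `U(2,1)`: coordinates, the phase element and the rotation element of `K = U(2) × U(1)` -/
section U21

variable {V : Type} [AddCommGroup V] [Module ℂ V]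
  (ρK : Representation ℂ (uFormGroup (Fin 2) (Fin 1)).maximalCompact V)
  (ρ𝔤 : (uFormGroup (Fin 2) (Fin 1)).lie →ₗ⁅ℝ⁆ Module.End ℂ V)
  (hV : ∀ (k : (uFormGroup (Fin 2) (Fin 1)).maximalCompact) (X : (uFormGroup (Fin 2) (Fin 1)).lie),
    ρK k ∘ₗ ρ𝔤 X ∘ₗ ρK k⁻¹ =
      ρ𝔤 ((uFormGroup (Fin 2) (Fin 1)).Ad
        (Subgroup.inclusion (uFormGroup (Fin 2) (Fin 1)).maximalCompact_le_carrier k) X))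

/-- **Coordinates**: `f(X) = λ(X₀) f(u₀) + λ(X₁) f(u₁)`, `λ(c) = Re c + δ i Im c`, `X_p` the `𝔭`-block entries.
[cite: BorelWallach2000, II §1.1 (3), §4.2 (3)] -/
theorem apply_eq_coord {δ : ℤ}
    {f : Cochain ℝ (uFormGroup (Fin 2) (Fin 1)).lie (GKCarrier (uFormGroup (Fin 2) (Fin 1)) ρ𝔤) 1}
    (hf : f ∈ upqType ρK ρ𝔤 hV 1 δ) (X : (uFormGroup (Fin 2) (Fin 1)).lie) :
    f ![X] =
      ((((X : Matrix (Fin 2 ⊕ Fin 1) (Fin 2 ⊕ Fin 1) ℂ) (Sum.inl 0) (Sum.inr 0)).re : ℂ) +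
          (((X : Matrix (Fin 2 ⊕ Fin 1) (Fin 2 ⊕ Fin 1) ℂ) (Sum.inl 0) (Sum.inr 0)).im : ℂ) * ((δ : ℂ) * Complex.I)) •
          f ![upqUnit ((0 : Fin 2), (0 : Fin 1)) 1] +
      ((((X : Matrix (Fin 2 ⊕ Fin 1) (Fin 2 ⊕ Fin 1) ℂ) (Sum.inl 1) (Sum.inr 0)).re : ℂ) +
          (((X : Matrix (Fin 2 ⊕ Fin 1) (Fin 2 ⊕ Fin 1) ℂ) (Sum.inl 1) (Sum.inr 0)).im : ℂ) * ((δ : ℂ) * Complex.I)) •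
          f ![upqUnit ((1 : Fin 2), (0 : Fin 1)) 1] := by
  obtain ⟨hfC, -⟩ := (mem_upqType_iff ρK ρ𝔤 hV 1 δ f).1 hf
  set M : Matrix (Fin 2 ⊕ Fin 1) (Fin 2 ⊕ Fin 1) ℂ := (X : Matrix (Fin 2 ⊕ Fin 1) (Fin 2 ⊕ Fin 1) ℂ) with hM
  have hk := upq_sub_offDiag_mem_kInLie X
  have hB : (⟨Matrix.fromBlocks 0 M.toBlocks₁₂ (M.toBlocks₁₂)ᴴ 0, upq_offDiag_mem_lie _⟩ :
      (uFormGroup (Fin 2) (Fin 1)).lie) =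
        upqUnit ((0 : Fin 2), (0 : Fin 1)) (M (Sum.inl 0) (Sum.inr 0)) +
          upqUnit ((1 : Fin 2), (0 : Fin 1)) (M (Sum.inl 1) (Sum.inr 0)) := by
    have hb : M.toBlocks₁₂ = Matrix.single (0 : Fin 2) (0 : Fin 1) (M (Sum.inl 0) (Sum.inr 0)) +
        Matrix.single (1 : Fin 2) (0 : Fin 1) (M (Sum.inl 1) (Sum.inr 0)) := by
      ext i j; fin_cases i <;> fin_cases j <;> simp [Matrix.toBlocks₁₂]
    apply Subtype.ext
    rw [AddMemClass.coe_add, coe_upqUnit, coe_upqUnit, Matrix.fromBlocks_add, add_zero, add_zero,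
      ← Matrix.conjTranspose_add, ← hb]
  have hX : X = (X - ⟨Matrix.fromBlocks 0 M.toBlocks₁₂ (M.toBlocks₁₂)ᴴ 0, upq_offDiag_mem_lie _⟩) +
      ⟨Matrix.fromBlocks 0 M.toBlocks₁₂ (M.toBlocks₁₂)ᴴ 0, upq_offDiag_mem_lie _⟩ := (sub_add_cancel _ _).symm
  rw [hX, cochainOne_apply_add, apply_eq_zero_of_mem_kInLie ρK ρ𝔤 hV hfC hk, zero_add, hB, cochainOne_apply_add,
    apply_upqUnit ρK ρ𝔤 hV hf ((0 : Fin 2), (0 : Fin 1)) (M (Sum.inl 0) (Sum.inr 0)),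
    apply_upqUnit ρK ρ𝔤 hV hf ((1 : Fin 2), (0 : Fin 1)) (M (Sum.inl 1) (Sum.inr 0))]

/-- The coefficient `λ(c) = Re c + δ i Im c` (`δ = ±1`) vanishes only for `c = 0`. [folklore] -/
theorem coord_eq_zero {δ : ℤ} (hδ : δ = 1 ∨ δ = -1) {c : ℂ}
    (h : (c.re : ℂ) + (c.im : ℂ) * ((δ : ℂ) * Complex.I) = 0) : c = 0 := by
  apply Complex.ext
  · simpa using congrArg Complex.re h
  · rcases hδ with rfl | rfl <;> simpa using congrArg Complex.im h

/-- **Phase element** `κ₀ = diag(i, 1; 1)`: `Ad κ₀ X_{cE_0} = X_{icE_0} = ⁅z₀, X_{cE_0}⁆`.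
[cite: BorelWallach2000, II §4.1] -/
theorem Ad_phase_upqUnit_zero (c : ℂ) :
    (uFormGroup (Fin 2) (Fin 1)).Ad (Subgroup.inclusion (uFormGroup (Fin 2) (Fin 1)).maximalCompact_le_carrier
        ⟨_, upq_kV_mem_maximalCompact (phaseDiag 0) 1⟩) (upqUnit ((0 : Fin 2), (0 : Fin 1)) c) =
      ⁅upqZ0 (Fin 2) (Fin 1), upqUnit ((0 : Fin 2), (0 : Fin 1)) c⁆ := by
  rw [lie_upqZ0_upqUnit]
  refine (upq_Ad_kV_offDiag (phaseDiag 0) 1 (Matrix.single (0 : Fin 2) (0 : Fin 1) c)).trans ?_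
  apply Subtype.ext
  have hB : ((phaseDiag 0 : Matrix.unitaryGroup (Fin 2) ℂ) : Matrix (Fin 2) (Fin 2) ℂ) *
      Matrix.single (0 : Fin 2) (0 : Fin 1) c * ((1 : Matrix.unitaryGroup (Fin 1) ℂ) : Matrix (Fin 1) (Fin 1) ℂ)ᴴ =
        Matrix.single (0 : Fin 2) (0 : Fin 1) (Complex.I * c) := by
    rw [coe_phaseDiag, OneMemClass.coe_one, Matrix.conjTranspose_one, Matrix.mul_one]
    ext i j; fin_cases i <;> fin_cases j <;> simp
  change Matrix.fromBlocks 0 _ _ 0 = Matrix.fromBlocks 0 _ _ 0; rw [hB]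

/-- **Phase element**: `Ad κ₀ X_{cE_1} = X_{cE_1}`. [cite: BorelWallach2000, II §4.1] -/
theorem Ad_phase_upqUnit_one (c : ℂ) :
    (uFormGroup (Fin 2) (Fin 1)).Ad (Subgroup.inclusion (uFormGroup (Fin 2) (Fin 1)).maximalCompact_le_carrier
        ⟨_, upq_kV_mem_maximalCompact (phaseDiag 0) 1⟩) (upqUnit ((1 : Fin 2), (0 : Fin 1)) c) =
      upqUnit ((1 : Fin 2), (0 : Fin 1)) c := by
  refine (upq_Ad_kV_offDiag (phaseDiag 0) 1 (Matrix.single (1 : Fin 2) (0 : Fin 1) c)).trans ?_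
  apply Subtype.ext
  have hB : ((phaseDiag 0 : Matrix.unitaryGroup (Fin 2) ℂ) : Matrix (Fin 2) (Fin 2) ℂ) *
      Matrix.single (1 : Fin 2) (0 : Fin 1) c * ((1 : Matrix.unitaryGroup (Fin 1) ℂ) : Matrix (Fin 1) (Fin 1) ℂ)ᴴ =
        Matrix.single (1 : Fin 2) (0 : Fin 1) c := by
    rw [coe_phaseDiag, OneMemClass.coe_one, Matrix.conjTranspose_one, Matrix.mul_one]
    ext i j; fin_cases i <;> fin_cases j <;> simp
  change Matrix.fromBlocks 0 _ _ 0 = Matrix.fromBlocks 0 _ _ 0; rw [hB]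

/-- **Rotation element** `κ_r = diag(w, 1)`, `w = (1/5)[[3,4],[−4,3]]`: `Ad κ_r u₀ = (3/5) u₀ − (4/5) u₁`.
[cite: BorelWallach2000, II §4.1] -/
theorem Ad_rot_upqUnit_zero :
    (uFormGroup (Fin 2) (Fin 1)).Ad (Subgroup.inclusion (uFormGroup (Fin 2) (Fin 1)).maximalCompact_le_carrier
        ⟨_, upq_kV_mem_maximalCompact rotW 1⟩) (upqUnit ((0 : Fin 2), (0 : Fin 1)) 1) =
      (3 / 5 : ℝ) • upqUnit ((0 : Fin 2), (0 : Fin 1)) 1 + (-4 / 5 : ℝ) • upqUnit ((1 : Fin 2), (0 : Fin 1)) 1 := by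
  refine (upq_Ad_kV_offDiag rotW 1 (Matrix.single (0 : Fin 2) (0 : Fin 1) (1 : ℂ))).trans ?_
  rw [upq_real_smul_upqUnit, upq_real_smul_upqUnit, mul_one, mul_one]
  apply Subtype.ext
  have hB : ((rotW : Matrix.unitaryGroup (Fin 2) ℂ) : Matrix (Fin 2) (Fin 2) ℂ) *
      Matrix.single (0 : Fin 2) (0 : Fin 1) (1 : ℂ) *
        ((1 : Matrix.unitaryGroup (Fin 1) ℂ) : Matrix (Fin 1) (Fin 1) ℂ)ᴴ =
        Matrix.single (0 : Fin 2) (0 : Fin 1) (((3 / 5 : ℝ) : ℂ)) +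
          Matrix.single (1 : Fin 2) (0 : Fin 1) (((-4 / 5 : ℝ) : ℂ)) := by
    rw [coe_rotW, OneMemClass.coe_one, Matrix.conjTranspose_one, Matrix.mul_one]
    ext i j; fin_cases i <;> fin_cases j <;> simp [Matrix.mul_apply, Matrix.single_apply]
  rw [AddMemClass.coe_add, coe_upqUnit, coe_upqUnit, Matrix.fromBlocks_add, add_zero, add_zero,
    ← Matrix.conjTranspose_add, ← hB]

/-- **Rotation element**: `Ad κ_r u₁ = (4/5) u₀ + (3/5) u₁`. [cite: BorelWallach2000, II §4.1] -/
theorem Ad_rot_upqUnit_one :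
    (uFormGroup (Fin 2) (Fin 1)).Ad (Subgroup.inclusion (uFormGroup (Fin 2) (Fin 1)).maximalCompact_le_carrier
        ⟨_, upq_kV_mem_maximalCompact rotW 1⟩) (upqUnit ((1 : Fin 2), (0 : Fin 1)) 1) =
      (4 / 5 : ℝ) • upqUnit ((0 : Fin 2), (0 : Fin 1)) 1 + (3 / 5 : ℝ) • upqUnit ((1 : Fin 2), (0 : Fin 1)) 1 := by
  refine (upq_Ad_kV_offDiag rotW 1 (Matrix.single (1 : Fin 2) (0 : Fin 1) (1 : ℂ))).trans ?_
  rw [upq_real_smul_upqUnit, upq_real_smul_upqUnit, mul_one, mul_one]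
  apply Subtype.ext
  have hB : ((rotW : Matrix.unitaryGroup (Fin 2) ℂ) : Matrix (Fin 2) (Fin 2) ℂ) *
      Matrix.single (1 : Fin 2) (0 : Fin 1) (1 : ℂ) *
        ((1 : Matrix.unitaryGroup (Fin 1) ℂ) : Matrix (Fin 1) (Fin 1) ℂ)ᴴ =
        Matrix.single (0 : Fin 2) (0 : Fin 1) (((4 / 5 : ℝ) : ℂ)) +
          Matrix.single (1 : Fin 2) (0 : Fin 1) (((3 / 5 : ℝ) : ℂ)) := by
    rw [coe_rotW, OneMemClass.coe_one, Matrix.conjTranspose_one, Matrix.mul_one]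
    ext i j; fin_cases i <;> fin_cases j <;> simp [Matrix.mul_apply, Matrix.single_apply]
  rw [AddMemClass.coe_add, coe_upqUnit, coe_upqUnit, Matrix.fromBlocks_add, add_zero, add_zero,
    ← Matrix.conjTranspose_add, ← hB]

/-- **Phase splitting**: if `w = a f(u₀) + b f(u₁)` for a `(𝔤, K)`-cochain `f` of type `δ`, then
`ρK(κ₀) w = δ i · a f(u₀) + b f(u₁)`. [cite: BorelWallach2000, II §4.1] -/
theorem kAct_phase_coord {δ : ℤ}
    {f : Cochain ℝ (uFormGroup (Fin 2) (Fin 1)).lie (GKCarrier (uFormGroup (Fin 2) (Fin 1)) ρ𝔤) 1}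
    (hf : f ∈ upqType ρK ρ𝔤 hV 1 δ) (a b : ℂ) :
    (gkPairAction (uFormGroup (Fin 2) (Fin 1)) ρK ρ𝔤 hV).τ ⟨_, upq_kV_mem_maximalCompact (phaseDiag 0) 1⟩
        (a • f ![upqUnit ((0 : Fin 2), (0 : Fin 1)) 1] + b • f ![upqUnit ((1 : Fin 2), (0 : Fin 1)) 1]) =
      (((δ : ℂ) * Complex.I) * a) • f ![upqUnit ((0 : Fin 2), (0 : Fin 1)) 1] +
        b • f ![upqUnit ((1 : Fin 2), (0 : Fin 1)) 1] := by
  obtain ⟨hfC, -⟩ := (mem_upqType_iff ρK ρ𝔤 hV 1 δ f).1 hf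
  rw [map_add, PairAction.SMulComm.τ_smul, PairAction.SMulComm.τ_smul, kAct_apply ρK ρ𝔤 hV hfC,
    kAct_apply ρK ρ𝔤 hV hfC, Ad_phase_upqUnit_zero, Ad_phase_upqUnit_one, apply_lie_upqZ0 ρK ρ𝔤 hV hf, smul_smul,
    mul_comm a]

end U21

/-- **Stub T6k of `Lines/F0_EngineLocalPackets.lean` ed. 2, proved** (the body of `StubT6kU21PGeometry`, binder for
binder): for any `Ad`-compatible pair `(ρK, ρ𝔤)` of `U(2,1)` and `(𝔤, K)`-1-cochains `f ≠ 0`, `g` of the same type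
`δ = ±1`: (1) `f(X) = 0 ↔ X ∈ 𝔨`; (2) if `g` takes values in `span_ℂ f(𝔤)` then `g = c • f` for a complex `c`.
[cite: BorelWallach2000, II §4.1–4.2] [cite: Rogawski1990, §12.3 p. 178] -/
theorem stubT6k_holds :
    ∀ (V : Type) [AddCommGroup V] [Module ℂ V]
      (ρK : Representation ℂ (uFormGroup (Fin 2) (Fin 1)).maximalCompact V)
      (ρ𝔤 : (uFormGroup (Fin 2) (Fin 1)).lie →ₗ⁅ℝ⁆ Module.End ℂ V)
      (hV : ∀ (k : (uFormGroup (Fin 2) (Fin 1)).maximalCompact) (X : (uFormGroup (Fin 2) (Fin 1)).lie),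
        ρK k ∘ₗ ρ𝔤 X ∘ₗ ρK k⁻¹ =
          ρ𝔤 ((uFormGroup (Fin 2) (Fin 1)).Ad
            (Subgroup.inclusion (uFormGroup (Fin 2) (Fin 1)).maximalCompact_le_carrier k) X))
      (δ : ℤ), δ = 1 ∨ δ = -1 →
      ∀ (f g : Cochain ℝ (uFormGroup (Fin 2) (Fin 1)).lie (GKCarrier (uFormGroup (Fin 2) (Fin 1)) ρ𝔤) 1),
        f ∈ upqType ρK ρ𝔤 hV 1 δ → g ∈ upqType ρK ρ𝔤 hV 1 δ → f ≠ 0 →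
        (∀ X : (uFormGroup (Fin 2) (Fin 1)).lie, f ![X] = 0 ↔ X ∈ (uFormGroup (Fin 2) (Fin 1)).kInLie) ∧
        ((∀ X : (uFormGroup (Fin 2) (Fin 1)).lie,
            g ![X] ∈ Submodule.span ℂ (Set.range fun Y : (uFormGroup (Fin 2) (Fin 1)).lie => f ![Y])) →
          ∃ c : ℂ, ∀ X : (uFormGroup (Fin 2) (Fin 1)).lie, g ![X] = c • f ![X]) := by
  intro V _ _ ρK ρ𝔤 hV δ hδ f g hf hg hf0
  obtain ⟨hfC, -⟩ := (mem_upqType_iff ρK ρ𝔤 hV 1 δ f).1 hf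
  obtain ⟨hgC, -⟩ := (mem_upqType_iff ρK ρ𝔤 hV 1 δ g).1 hg
  -- the scalar `μ = δ i` has `μ ≠ 1` and `μ − 1 ≠ 0`
  have hμ1 : ((δ : ℂ) * Complex.I) - 1 ≠ 0 := by
    intro h
    have e := congrArg Complex.re h
    simp at e
  -- names for the two unit directions and their values
  obtain ⟨u₀, hu₀⟩ : ∃ u₀ : (uFormGroup (Fin 2) (Fin 1)).lie, u₀ = upqUnit ((0 : Fin 2), (0 : Fin 1)) 1 := ⟨_, rfl⟩
  obtain ⟨u₁, hu₁⟩ : ∃ u₁ : (uFormGroup (Fin 2) (Fin 1)).lie, u₁ = upqUnit ((1 : Fin 2), (0 : Fin 1)) 1 := ⟨_, rfl⟩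
  -- the two `K`-elements, in their `GKCarrier` dress
  obtain ⟨τr, hτr⟩ : ∃ τr : GKCarrier (uFormGroup (Fin 2) (Fin 1)) ρ𝔤 →ₗ[ℝ] GKCarrier (uFormGroup (Fin 2) (Fin 1)) ρ𝔤,
      (gkPairAction (uFormGroup (Fin 2) (Fin 1)) ρK ρ𝔤 hV).τ ⟨_, upq_kV_mem_maximalCompact rotW 1⟩ = τr := ⟨_, rfl⟩
  obtain ⟨τp, hτp⟩ : ∃ τp : GKCarrier (uFormGroup (Fin 2) (Fin 1)) ρ𝔤 →ₗ[ℝ] GKCarrier (uFormGroup (Fin 2) (Fin 1)) ρ𝔤,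
      (gkPairAction (uFormGroup (Fin 2) (Fin 1)) ρK ρ𝔤 hV).τ ⟨_, upq_kV_mem_maximalCompact (phaseDiag 0) 1⟩ = τp :=
    ⟨_, rfl⟩
  have hτr_smul : ∀ (c : ℂ) (v : GKCarrier (uFormGroup (Fin 2) (Fin 1)) ρ𝔤), τr (c • v) = c • τr v := by
    intro c v; rw [← hτr]; exact PairAction.SMulComm.τ_smul _ c v
  -- (c) the rotation on values of any `(𝔤, K)`-cochain `h`
  have hrot : ∀ {h : Cochain ℝ (uFormGroup (Fin 2) (Fin 1)).lie (GKCarrier (uFormGroup (Fin 2) (Fin 1)) ρ𝔤) 1},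
      h ∈ (gkComplex (uFormGroup (Fin 2) (Fin 1)) ρK ρ𝔤 hV).carrier 1 →
      (τr (h ![u₀]) = (((3 / 5 : ℝ) : ℂ)) • h ![u₀] + (((-4 / 5 : ℝ) : ℂ)) • h ![u₁]) ∧
      (τr (h ![u₁]) = (((4 / 5 : ℝ) : ℂ)) • h ![u₀] + (((3 / 5 : ℝ) : ℂ)) • h ![u₁]) := by
    intro h hh
    refine ⟨?_, ?_⟩
    · rw [← hτr, kAct_apply ρK ρ𝔤 hV hh, hu₀, Ad_rot_upqUnit_zero, cochainOne_apply_add, cochainOne_apply_smul,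
        cochainOne_apply_smul, hu₁]
    · rw [← hτr, kAct_apply ρK ρ𝔤 hV hh, hu₁, Ad_rot_upqUnit_one, cochainOne_apply_add, cochainOne_apply_smul,
        cochainOne_apply_smul, hu₀]
  have h45 : (((-4 / 5 : ℝ) : ℂ)) ≠ 0 := Complex.ofReal_ne_zero.2 (by norm_num)
  have h45' : (((4 / 5 : ℝ) : ℂ)) ≠ 0 := Complex.ofReal_ne_zero.2 (by norm_num)
  -- `f(u₀) ≠ 0` and `f(u₁) ≠ 0`
  have hvals : f ![u₀] ≠ 0 ∧ f ![u₁] ≠ 0 := by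
    have key : f ![u₀] = 0 ↔ f ![u₁] = 0 := by
      refine ⟨fun h0 => ?_, fun h1 => ?_⟩
      · have e := (hrot hfC).1
        rw [h0, map_zero, smul_zero, zero_add, eq_comm, smul_eq_zero] at e
        exact e.resolve_left h45
      · have e := (hrot hfC).2
        rw [h1, map_zero, smul_zero, add_zero, eq_comm, smul_eq_zero] at e
        exact e.resolve_left h45'
    by_contra hne
    have h0 : f ![u₀] = 0 := by by_contra h0; exact hne ⟨h0, fun h1 => h0 (key.2 h1)⟩
    refine hf0 (cochainOne_eq_zero ρ𝔤 fun Y => ?_)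
    rw [apply_eq_coord ρK ρ𝔤 hV hf Y, ← hu₀, ← hu₁, h0, key.1 h0, smul_zero, smul_zero, add_zero]
  -- (b) phase splitting: `a f(u₀) + b f(u₁) = w`, `τp w = w` ⇒ `a = 0`; `τp w = μ w` ⇒ `b = 0`
  have hphase : ∀ a b : ℂ, τp (a • f ![u₀] + b • f ![u₁]) =
      (((δ : ℂ) * Complex.I) * a) • f ![u₀] + b • f ![u₁] := by
    intro a b; rw [← hτp, hu₀, hu₁]; exact kAct_phase_coord ρK ρ𝔤 hV hf a b
  have hsplit_fix : ∀ (a b : ℂ) (w : GKCarrier (uFormGroup (Fin 2) (Fin 1)) ρ𝔤),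
      a • f ![u₀] + b • f ![u₁] = w → τp w = w → a = 0 := by
    intro a b w hw hτw
    have e := hphase a b
    rw [hw, hτw, ← hw, add_left_inj] at e
    -- e : a • f u₀ = (μ * a) • f u₀
    have e' : ((((δ : ℂ) * Complex.I) - 1) * a) • f ![u₀] = 0 := by
      rw [sub_mul, one_mul, sub_smul, ← e, sub_self]
    exact ((smul_eq_zero.1 e').resolve_right hvals.1) |> fun h => (mul_eq_zero.1 h).resolve_left hμ1
  have hsplit_rot : ∀ (a b : ℂ) (w : GKCarrier (uFormGroup (Fin 2) (Fin 1)) ρ𝔤),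
      a • f ![u₀] + b • f ![u₁] = w → τp w = ((δ : ℂ) * Complex.I) • w → b = 0 := by
    intro a b w hw hτw
    have e := hphase a b
    rw [hw, hτw, ← hw, smul_add, smul_smul, smul_smul, add_right_inj] at e
    -- e : (μ * b) • f u₁ = b • f u₁
    have e' : ((((δ : ℂ) * Complex.I) - 1) * b) • f ![u₁] = 0 := by
      rw [sub_mul, one_mul, sub_smul, e, sub_self]
    exact ((smul_eq_zero.1 e').resolve_right hvals.2) |> fun h => (mul_eq_zero.1 h).resolve_left hμ1
  refine ⟨fun X => ⟨fun hX => ?_, fun hX => apply_eq_zero_of_mem_kInLie ρK ρ𝔤 hV hfC hX⟩, fun hgW => ?_⟩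
  · -- (1) `f(X) = 0 ⇒ X ∈ 𝔨`: both coordinates of `X` vanish
    rw [apply_eq_coord ρK ρ𝔤 hV hf X, ← hu₀, ← hu₁] at hX
    have c0 := coord_eq_zero hδ (hsplit_fix _ _ 0 hX (map_zero τp))
    have c1 := coord_eq_zero hδ (hsplit_rot _ _ 0 hX (by rw [map_zero, smul_zero]))
    rw [upq_mem_kInLie_iff_blocks]
    ext i j; fin_cases i <;> fin_cases j; exacts [c0, c1]
  · -- (2) Schur: `g(u₀) = a f(u₀)`, `g(u₁) = b' f(u₁)`, `b' = a`, then coordinates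
    have hW : Submodule.span ℂ (Set.range fun Y : (uFormGroup (Fin 2) (Fin 1)).lie => f ![Y]) ≤
        Submodule.span ℂ {f ![u₀], f ![u₁]} := by
      rw [Submodule.span_le]
      rintro _ ⟨Y, rfl⟩
      change f ![Y] ∈ _
      rw [SetLike.mem_coe, apply_eq_coord ρK ρ𝔤 hV hf Y, ← hu₀, ← hu₁]
      exact add_mem (Submodule.smul_mem _ _ (Submodule.subset_span (by simp)))
        (Submodule.smul_mem _ _ (Submodule.subset_span (by simp)))
    obtain ⟨a, b, hab⟩ := Submodule.mem_span_pair.1 (hW (hgW u₀))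
    obtain ⟨a', b', hab'⟩ := Submodule.mem_span_pair.1 (hW (hgW u₁))
    -- `τp (g u₀) = g (⁅z₀, u₀⁆) = μ g(u₀)` and `τp (g u₁) = g u₁`
    have hg0 : τp (g ![u₀]) = ((δ : ℂ) * Complex.I) • g ![u₀] := by
      rw [← hτp, kAct_apply ρK ρ𝔤 hV hgC, hu₀, Ad_phase_upqUnit_zero, apply_lie_upqZ0 ρK ρ𝔤 hV hg]
    have hg1 : τp (g ![u₁]) = g ![u₁] := by
      rw [← hτp, kAct_apply ρK ρ𝔤 hV hgC, hu₁, Ad_phase_upqUnit_one]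
    have hb : b = 0 := hsplit_rot a b _ hab hg0
    have ha' : a' = 0 := hsplit_fix a' b' _ hab' hg1
    rw [hb, zero_smul, add_zero] at hab
    rw [ha', zero_smul, zero_add] at hab'
    -- rotation: `τr (g u₀) = a τr (f u₀)` ⇒ `b' = a`
    have hba : b' = a := by
      have e4 := (hrot hgC).1
      rw [← hab, ← hab', hτr_smul, (hrot hfC).1, smul_add, smul_smul, smul_smul, smul_smul, smul_smul,
        mul_comm a (((3 / 5 : ℝ) : ℂ)), add_right_inj] at e4
      -- e4 : (a * c) • f u₁ = (c * b') • f u₁, c = -4/5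
      have e5 : ((((-4 / 5 : ℝ) : ℂ)) * (a - b')) • f ![u₁] = 0 := by
        rw [mul_sub, sub_smul, mul_comm _ a, e4, sub_self]
      exact (sub_eq_zero.1 ((mul_eq_zero.1 ((smul_eq_zero.1 e5).resolve_right hvals.2)).resolve_left h45)).symm
    refine ⟨a, fun X => ?_⟩
    rw [apply_eq_coord ρK ρ𝔤 hV hg X, apply_eq_coord ρK ρ𝔤 hV hf X, ← hu₀, ← hu₁, ← hab, ← hab', hba, smul_add,
      smul_comm _ a, smul_comm _ a]

end Summit.HodgeConjecture.HodgeConjecture.Cruxes.H413.F0P3bStubT6kU21PGeometry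

end
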